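import Literature.Topology.FourManifolds.SlideStub
import HarnessLib

/-!
# The short stubs stay below the upper tip in twisted height (constant end rate, upper side)

Topic `Literature/Topology/FourManifolds`; fact seat `provefact-IsStrictHandleSlide.isSurgery`
(R. C. Kirby, *The Topology of 4-Manifolds*, LNM 1374 (1989), Ch. I §4, Fig. 4.2; remaining content:
the named fact (S) `Literature.Topology.FourManifolds.FramedLink.IsStrictHandleSlide.slideModel`).
Mirror of `SlideStub.lean` for the upper track in the reflected height (`routeHypUp`, rate
`e ∘ (1 - ·) = e₀`, slice angle `Θup = φ - ΘB (1 - ·)`): on the upper stub set the reflected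
twisted height `Rup.y` exceeds the upper tip height `r_Dᵘ` (`rDu_lt_y_of_mem_stubSetUp`), i.e.
read forward the stub of the slid circle beyond the upper tip has height `< -r_Dᵘ`.

## References

* R. C. Kirby, *The Topology of 4-Manifolds*, LNM 1374, Springer (1989), Ch. I §4. [Kirby1989]
-/

open scoped Topology ContDiff
open Set Real Filter

noncomputable section

namespace Literature.Topology.FourManifolds

namespace BandCore

variable {A B : Knot} {avoid : Set (Metric.sphere (0 : EuclideanSpace ℝ (Fin 4)) 1)} {c : BandCore A B avoid}

namespace SlideChoice

variable {e₀ : ℝ} (P : c.SlideChoice (fun _ ↦ e₀)) (he₀ : 0 < e₀)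

/-- The upper route hypotheses for the constant rate. [folklore] -/
def Ru : RouteHyp P.du := P.routeHypUp (he_const e₀)

/-- **The stub set**: parameters in the window, up to the tip, with abscissa at least `1 - 2κ_D`. [folklore] -/
def stubSetUp : Set ℝ := {t | t ∈ Icc (P.du.b - P.du.ε) P.du.tD ∧ 1 - 2 * P.κD ≤ P.du.Xl t}

/-- `tD_mem_stubSetUp` (auxiliary). [folklore] -/
theorem tD_mem_stubSetUpUp : P.du.tD ∈ P.stubSetUp :=
  ⟨⟨P.du.tD_mem.1.le, le_rfl⟩, by rw [P.du.Xl_tD]; show 1 - 2 * P.κD ≤ 1 - P.κD; linarith [P.κD_pos]⟩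

variable {P}

/-! ### Local formulas on the stub set -/

/-- `stubU_I` (auxiliary). [folklore] -/
theorem stubU_I {t : ℝ} (ht : t ∈ P.stubSetUp) : t ∈ Icc (P.du.b - P.du.ε) (P.du.b - P.du.ε / 2) :=
  ⟨ht.1.1, ht.1.2.trans P.du.tD_mem.2.le⟩

/-- `stubU_Xl_le` (auxiliary). [folklore] -/
theorem stubU_Xl_le {t : ℝ} (ht : t ∈ P.stubSetUp) : P.du.Xl t ≤ P.du.xD := by
  rw [← P.du.Xl_tD]
  exact P.du.Xl_le_Xl ht.1.2 (by linarith [P.du.tD_mem.2, P.du.ε_pos])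

/-- `stubU_Sr` (auxiliary). [folklore] -/
theorem du_κ₀ (P : c.SlideChoice (fun _ ↦ e₀)) : P.du.κ₀ = 2⁻¹ := rfl

/-- `stubU_lt_Xl` (auxiliary). [folklore] -/
theorem stubU_lt_Xl {t : ℝ} (ht : t ∈ P.stubSetUp) : 1 - P.du.κ₀ < P.du.Xl t := by
  have := ht.2; have := P.κD_le_eighth; rw [du_κ₀]; linarith

/-- `stubU_Sr` (auxiliary). [folklore] -/
theorem stubU_Sr {t : ℝ} (ht : t ∈ P.stubSetUp) : P.du.Sr (P.du.Hh t) = P.du.Xl t - (1 - P.du.κ₀) := by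
  have hρ := P.du.ρt_eq_of_lt_ρt (h := P.du.Hh t) (stubU_lt_Xl ht)
  have : P.du.Xl t = P.du.ρt (P.du.Hh t) := rfl
  linarith

/-- `stubU_Sr_zone` (auxiliary). [folklore] -/
theorem stubU_Sr_zone {t : ℝ} (ht : t ∈ P.stubSetUp) :
    P.du.Sr (P.du.Hh t) ∈ Icc (P.du.κ₀ - 3 * P.du.κD) (P.du.κ₀ + 3 * P.du.κD) := by
  rw [stubU_Sr ht, du_κ₀]
  have h1 := ht.2; have h2 := stubU_Xl_le ht
  have hκ : P.du.κD = P.κD := rfl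
  rw [hκ] at *
  have hx : P.du.xD = 1 - P.κD := rfl
  rw [hx] at h2
  constructor <;> linarith [P.κD_pos]

/-- On the stub set the speed of the abscissa is at least `v_min`. [folklore] -/
theorem stubU_vmin_le {t : ℝ} (ht : t ∈ P.stubSetUp) : P.du.vmin ≤ deriv P.du.Xl t :=
  P.du.vmin_le_deriv_Xl (stubU_I ht) (stubU_Sr_zone ht)

/-- `stubU_deriv_Xl_le` (auxiliary). [folklore] -/
theorem stubU_deriv_Xl_le {t : ℝ} (ht : t ∈ P.stubSetUp) : deriv P.du.Xl t ≤ P.Mρ * c.liteMHU := by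
  have h := P.du.deriv_Xl_le P.CT_ge (τ := t) ⟨ht.1.1, by linarith [(stubU_I ht).2, P.du.ε_pos]⟩
  have hM : P.du.Mρ_of P.CT ≤ P.Mρ := P.Mρ_geᵤ
  exact h.trans (mul_le_mul_of_nonneg_right hM c.liteMHU_pos.le)

/-- The stub set is "convex up to the tip": between a stub parameter and the tip everything is a
stub parameter. [folklore] -/
theorem stubU_of_le {t t' : ℝ} (ht : t ∈ P.stubSetUp) (htt' : t ≤ t') (ht' : t' ≤ P.du.tD) : t' ∈ P.stubSetUp := by
  refine ⟨⟨ht.1.1.trans htt', ht'⟩, ht.2.trans ?_⟩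
  exact P.du.Xl_le_Xl htt' (by linarith [P.du.tD_mem.2, P.du.ε_pos])

/-- The height on the stub set lies in `(hr0, h_D]`. [folklore] -/
theorem stubU_Hh_mem {t : ℝ} (ht : t ∈ P.stubSetUp) : P.du.Hh t ∈ Ioc P.du.hr0 (P.du.Hh P.du.tD) := by
  constructor
  · exact P.du.hr0_lt_of_lt_ρt (stubU_lt_Xl ht)
  · exact P.du.Hh_le_Hh ht.1.2 (by linarith [P.du.tD_mem.2, P.du.ε_pos])

/-- `stubU_Hh_win` (auxiliary). [folklore] -/
theorem stubU_Hh_win {t : ℝ} (ht : t ∈ P.stubSetUp) : P.du.Hh t ∈ Ioo (P.du.hr0 - 2 * P.μ) (P.du.hr1 + P.μ) := by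
  have h := stubU_Hh_mem ht; have hD := P.hD'_mem
  exact ⟨by linarith [h.1, P.μ_pos], by linarith [h.2, hD.2, P.μ_pos]⟩

/-- Below the tip: `X₁ = X_l` and `H₁ = Hh` near every `t < t_D`. [folklore] -/
theorem X₁_eventuallyEq_Xl_up {t : ℝ} (ht : t < P.du.tD) : P.du.X₁ =ᶠ[𝓝 t] P.du.Xl := by
  filter_upwards [Iio_mem_nhds ht] with s hs
  exact P.du.X₁_eq_Xl_of_lt_tD hs

/-- `H₁_eq_Hh_of_le_up` (auxiliary). [folklore] -/
theorem H₁_eq_Hh_of_le_up {t : ℝ} (ht : t ≤ P.du.tD) : P.du.H₁ t = P.du.Hh t := by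
  have hXg : P.du.Xg t = P.du.Xl t := P.du.Xg_of_le (by linarith [P.du.tD_mem.2, P.du.ε_pos])
  have hXl : P.du.Xl t ≤ P.du.xD := by
    rcases eq_or_lt_of_le ht with h | h
    · rw [h, P.du.Xl_tD]
    · rw [← P.du.X₁_eq_Xl_of_lt_tD h]; exact (P.du.X₁_lt_xD_of_lt_tD h).le
  have hS : P.du.S₂ t = 0 := P.du.S₂_of_le (by rw [hXg]; have : P.du.xD = 1 - P.du.κD := rfl; linarith [P.du.κD_pos])
  rw [K2LiteData.H₁, hS, P.du.P_of_Xg_le (by rw [hXg]; exact hXl)]; ring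

/-- `H₁_eventuallyEq_Hh_up` (auxiliary). [folklore] -/
theorem H₁_eventuallyEq_Hh_up {t : ℝ} (ht : t < P.du.tD) : P.du.H₁ =ᶠ[𝓝 t] P.du.Hh := by
  filter_upwards [Iio_mem_nhds ht] with s hs
  exact H₁_eq_Hh_of_le_up hs.le

/-! ### The route quantities on the stub set -/

/-- `stubU_r_eq` (auxiliary). [folklore] -/
theorem stubU_r_eq {t : ℝ} (ht : t ∈ P.stubSetUp) : P.Ru.r t = 1 + (1 - P.du.Xl t) * e₀ := by
  show 1 + (1 - P.du.X₁ t) * e₀ = _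
  rcases eq_or_lt_of_le ht.1.2 with h | h
  · rw [h, RouteHyp.X₁_tD (d := P.du), P.du.Xl_tD]
  · rw [P.du.X₁_eq_Xl_of_lt_tD h]

/-- `stubU_r_mem` (auxiliary). [folklore] -/
theorem stubU_r_mem (he₀ : 0 < e₀) {t : ℝ} (ht : t ∈ P.stubSetUp) : P.Ru.r t ∈ Icc P.rDu (1 + 2 * P.κD * e₀) := by
  rw [stubU_r_eq ht, rDu]
  have h1 := ht.2; have h2 := stubU_Xl_le ht
  have hx : P.du.xD = 1 - P.κD := rfl
  constructor <;> nlinarith [he₀]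

/-- `stubU_θ_eq` (auxiliary). [folklore] -/
theorem stubU_θ_eq {t : ℝ} (ht : t ∈ P.stubSetUp) : P.Ru.θ t = P.Θup (P.du.Hh t) := by
  show P.Θup (P.du.H₁ t) = _; rw [H₁_eq_Hh_of_le_up ht.1.2]

/-- `stubU_θ_mem` (auxiliary). [folklore] -/
theorem stubU_θ_mem {t : ℝ} (ht : t ∈ P.stubSetUp) : P.Ru.θ t ∈ Icc (c.θlow / 2) (π - c.θlow / 2) := by
  rw [stubU_θ_eq ht]; exact P.Θup_mem (stubU_Hh_win ht)

/-- `stubU_θ_mem_Ioo` (auxiliary). [folklore] -/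
theorem stubU_θ_mem_Ioo {t : ℝ} (ht : t ∈ P.stubSetUp) : P.Ru.θ t ∈ Ioo (-π) π := by
  have h := stubU_θ_mem ht; have := c.θlow_pos
  exact ⟨by linarith [h.1, pi_pos], by linarith [h.2]⟩


/-! ### Derivatives below the tip -/

/-- `stubU_Hh_Ioo` (auxiliary). [folklore] -/
theorem stubU_Hh_Ioo {t : ℝ} (ht : t ∈ P.stubSetUp) : P.du.Hh t ∈ Ioo (10⁻¹ : ℝ) (9 / 10) := by
  have h := P.winUp_sub (stubU_Hh_win ht); exact ⟨by linarith [h.1], by linarith [h.2]⟩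

/-- `stubU_hasDerivAt_r` (auxiliary). [folklore] -/
theorem stubU_hasDerivAt_r {t : ℝ} (ht : t < P.du.tD) : HasDerivAt P.Ru.r (-(deriv P.du.Xl t) * e₀) t := by
  have hX : HasDerivAt P.du.X₁ (deriv P.du.Xl t) t :=
    (P.du.hasDerivAt_Xl t).differentiableAt.hasDerivAt.congr_of_eventuallyEq (X₁_eventuallyEq_Xl_up ht)
  have : P.Ru.r = fun s ↦ 1 + (1 - P.du.X₁ s) * e₀ := rfl
  rw [this, show -(deriv P.du.Xl t) * e₀ = (0 - deriv P.du.Xl t) * e₀ by ring]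
  exact (((hasDerivAt_const t (1:ℝ)).sub hX).mul_const e₀).const_add 1

/-- `stubU_hasDerivAt_θ` (auxiliary). [folklore] -/
theorem stubU_hasDerivAt_θ {t : ℝ} (ht : t ∈ P.stubSetUp) (ht' : t < P.du.tD) :
    HasDerivAt P.Ru.θ (deriv c.ΘB (1 - P.du.Hh t) * deriv P.du.Hh t) t := by
  have hH : HasDerivAt P.du.H₁ (deriv P.du.Hh t) t :=
    (P.du.contDiff_Hh.differentiable (by simp) t).hasDerivAt.congr_of_eventuallyEq (H₁_eventuallyEq_Hh_up ht')
  have hw := stubU_Hh_Ioo ht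
  have h1w : 1 - P.du.H₁ t ∈ Ioo (10⁻¹ : ℝ) (9 / 10) := by
    rw [H₁_eq_Hh_of_le_up ht'.le]; exact P.winUp_refl' (stubU_Hh_win ht)
  have hΘ : HasDerivAt c.ΘB (deriv c.ΘB (1 - P.du.Hh t)) (1 - P.du.H₁ t) := by
    have := c.hasDerivAt_ΘB h1w; rwa [H₁_eq_Hh_of_le_up ht'.le] at this ⊢
  have hin : HasDerivAt (fun s ↦ 1 - P.du.H₁ s) (0 - deriv P.du.Hh t) t := (hasDerivAt_const t (1:ℝ)).sub hH
  have hcomp : HasDerivAt (c.ΘB ∘ fun s ↦ 1 - P.du.H₁ s) (deriv c.ΘB (1 - P.du.Hh t) * (0 - deriv P.du.Hh t)) t :=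
    hΘ.comp t hin
  have : P.Ru.θ = fun s ↦ P.φ - (c.ΘB ∘ fun s ↦ 1 - P.du.H₁ s) s := rfl
  rw [this, show deriv c.ΘB (1 - P.du.Hh t) * deriv P.du.Hh t = 0 - deriv c.ΘB (1 - P.du.Hh t) * (0 - deriv P.du.Hh t) by ring]
  exact (hasDerivAt_const t P.φ).sub hcomp

/-- `stubU_hasDerivAt_y` (auxiliary). [folklore] -/
theorem stubU_hasDerivAt_y {t : ℝ} (ht : t ∈ P.stubSetUp) (ht' : t < P.du.tD) :
    HasDerivAt P.Ru.y (-(deriv P.du.Xl t) * e₀ * sin (P.Ru.α t) +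
      P.Ru.r t * (cos (P.Ru.α t) * (P.tw * sin (P.Ru.α t) * (-(deriv P.du.Xl t) * e₀) +
        twistQ P.tw (P.Ru.r t) (P.Ru.θ t) * (deriv c.ΘB (1 - P.du.Hh t) * deriv P.du.Hh t)))) t :=
  hasDerivAt_curveY P.tw (stubU_hasDerivAt_r ht') (stubU_hasDerivAt_θ ht ht') (stubU_θ_mem_Ioo ht)

/-- `stubU_hasDerivAt_α` (auxiliary). [folklore] -/
theorem stubU_hasDerivAt_α {t : ℝ} (ht : t ∈ P.stubSetUp) (ht' : t < P.du.tD) :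
    HasDerivAt P.Ru.α (P.tw * sin (P.Ru.α t) * (-(deriv P.du.Xl t) * e₀) +
      twistQ P.tw (P.Ru.r t) (P.Ru.θ t) * (deriv c.ΘB (1 - P.du.Hh t) * deriv P.du.Hh t)) t :=
  hasDerivAt_twistAngle_curve P.tw (stubU_hasDerivAt_r ht') (stubU_hasDerivAt_θ ht ht') (stubU_θ_mem_Ioo ht)

/-! ### Bounds on the stub set -/

/-- The bound `Aα = cmax (Mρ MH e₀) + qmaxc MΘ MH` of `|α̇|`. [folklore] -/
def AαU : ℝ := c.cmax * (P.Mρ * c.liteMHU * e₀) + c.qmaxc * P.MΘ * c.liteMHU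

/-- The bound `s = Aα κ_D / v_min` of `|α - π/2|` on the stub set. [folklore] -/
def sαU : ℝ := P.AαU * P.κD / c.liteVminU2 P.μ_pos

/-- `Aα_nonneg` (auxiliary). [folklore] -/
theorem AαU_nonneg (he₀ : 0 ≤ e₀) : 0 ≤ P.AαU := by
  unfold AαU
  have := c.cmax_nonneg; have := P.Mρ_pos; have := c.liteMHU_pos; have := c.qmaxc_pos; have := P.MΘ_pos
  positivity

/-- `sα_nonneg` (auxiliary). [folklore] -/
theorem sαU_nonneg (he₀ : 0 ≤ e₀) : 0 ≤ P.sαU := by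
  unfold sαU
  have := P.AαU_nonneg he₀; have := (c.liteVminU2_spec P.μ_pos).1; have := P.κD_pos
  positivity

/-- `stubU_q_le` (auxiliary). [folklore] -/
theorem stubU_q_le {t : ℝ} (he₀ : 0 < e₀) (hκ2 : 2 * P.κD * e₀ ≤ 1) (ht : t ∈ P.stubSetUp) :
    twistQ P.tw (P.Ru.r t) (P.Ru.θ t) ≤ c.qmaxc := by
  have hr := stubU_r_mem he₀ ht; have hθ := stubU_θ_mem ht; have h1 := P.rDu_mem.1
  have h := twistQ_le_of (c := P.tw) (r := P.Ru.r t) (θ := P.Ru.θ t) (θmax := π - c.θlow / 2)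
    (by linarith [hr.1]) (by linarith [hr.2]) (by linarith [hθ.1, c.θlow_pos]) hθ.2 (by linarith [c.θlow_pos])
  exact h.trans P.qmax_le

/-- `stubU_θ'_abs_le` (auxiliary). [folklore] -/
theorem stubU_θ'_abs_le {t : ℝ} (ht : t ∈ P.stubSetUp) : |deriv c.ΘB (1 - P.du.Hh t) * deriv P.du.Hh t| ≤ P.MΘ * c.liteMHU := by
  have hΘ := P.Θ_deriv _ (P.winUp_refl (stubU_Hh_win ht))
  have hH0 : 0 < deriv P.du.Hh t := P.du.deriv_Hh_pos (by linarith [(stubU_I ht).2, P.du.ε_pos])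
  have hH1 : deriv P.du.Hh t ≤ c.liteMHU := P.du.deriv_Hh_le_MH ⟨ht.1.1, by linarith [(stubU_I ht).2, P.du.ε_pos]⟩
  rw [abs_mul, abs_of_pos hH0]
  have hM := P.MΘ_pos
  have : |deriv c.ΘB (1 - P.du.Hh t)| ≤ P.MΘ := abs_le.2 ⟨hΘ.1, by linarith [hΘ.2, P.mΘ_pos]⟩
  exact mul_le_mul this hH1 hH0.le hM.le

/-- `stubU_r'_abs_le` (auxiliary). [folklore] -/
theorem stubU_r'_abs_le {t : ℝ} (he₀ : 0 < e₀) (ht : t ∈ P.stubSetUp) : |-(deriv P.du.Xl t) * e₀| ≤ P.Mρ * c.liteMHU * e₀ := by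
  have h0 : 0 ≤ deriv P.du.Xl t := (c.liteVminU2_spec P.μ_pos).1.le.trans (stubU_vmin_le ht)
  rw [neg_mul, abs_neg, abs_of_nonneg (mul_nonneg h0 he₀.le)]
  exact mul_le_mul_of_nonneg_right (stubU_deriv_Xl_le ht) he₀.le

/-- `|α̇| ≤ Aα` on the open stub set. [folklore] -/
theorem stubU_deriv_α_abs_le {t : ℝ} (he₀ : 0 < e₀) (hκ2 : 2 * P.κD * e₀ ≤ 1) (ht : t ∈ P.stubSetUp) (ht' : t < P.du.tD) :
    |deriv P.Ru.α t| ≤ P.AαU := by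
  rw [(stubU_hasDerivAt_α ht ht').deriv, AαU]
  have h1 := stubU_r'_abs_le he₀ ht; have h2 := stubU_θ'_abs_le ht; have h3 := stubU_q_le he₀ hκ2 ht
  have hq0 : 0 ≤ twistQ P.tw (P.Ru.r t) (P.Ru.θ t) := (twistQ_pos _ _ (stubU_θ_mem_Ioo ht)).le
  have hc := P.abs_tw_le
  calc |P.tw * sin (P.Ru.α t) * (-(deriv P.du.Xl t) * e₀) + twistQ P.tw (P.Ru.r t) (P.Ru.θ t) * (deriv c.ΘB (1 - P.du.Hh t) * deriv P.du.Hh t)|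
      ≤ |P.tw * sin (P.Ru.α t) * (-(deriv P.du.Xl t) * e₀)| + |twistQ P.tw (P.Ru.r t) (P.Ru.θ t) * (deriv c.ΘB (1 - P.du.Hh t) * deriv P.du.Hh t)| :=
        abs_add_le _ _
    _ ≤ c.cmax * (P.Mρ * c.liteMHU * e₀) + c.qmaxc * (P.MΘ * c.liteMHU) := by
        refine add_le_add ?_ ?_
        · rw [abs_mul, abs_mul]
          have hs : |sin (P.Ru.α t)| ≤ 1 := abs_sin_le_one _
          calc |P.tw| * |sin (P.Ru.α t)| * |-(deriv P.du.Xl t) * e₀| ≤ c.cmax * 1 * (P.Mρ * c.liteMHU * e₀) :=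
                mul_le_mul (mul_le_mul hc hs (abs_nonneg _) c.cmax_nonneg) h1 (abs_nonneg _) (by have := c.cmax_nonneg; positivity)
            _ = c.cmax * (P.Mρ * c.liteMHU * e₀) := by ring
        · rw [abs_mul, abs_of_nonneg hq0]
          exact mul_le_mul h3 h2 (abs_nonneg _) c.qmaxc_pos.le
    _ = c.cmax * (P.Mρ * c.liteMHU * e₀) + c.qmaxc * P.MΘ * c.liteMHU := by ring

/-- The time to the tip is at most `κ_D / v_min`. [folklore] -/
theorem stubU_tD_sub_le {t : ℝ} (ht : t ∈ P.stubSetUp) : P.du.tD - t ≤ P.κD / c.liteVminU2 P.μ_pos := by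
  have hv := (c.liteVminU2_spec P.μ_pos).1
  rcases eq_or_lt_of_le ht.1.2 with h | h
  · rw [h, sub_self]; exact div_nonneg P.κD_pos.le hv.le
  obtain ⟨ξ, hξ, hslope⟩ := exists_hasDerivAt_eq_slope P.du.Xl (deriv P.du.Xl) h
    (P.du.contDiff_Xl.continuous.continuousOn) (fun s _ ↦ (P.du.hasDerivAt_Xl s).differentiableAt.hasDerivAt)
  have hξs : ξ ∈ P.stubSetUp := stubU_of_le ht hξ.1.le hξ.2.le
  have hv' : c.liteVminU2 P.μ_pos ≤ deriv P.du.Xl ξ := stubU_vmin_le hξs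
  have hdiff : P.du.Xl P.du.tD - P.du.Xl t ≤ P.κD := by
    rw [P.du.Xl_tD]; have := ht.2; show (1 - P.κD) - P.du.Xl t ≤ P.κD; linarith
  rw [le_div_iff₀ hv]
  have hpos : 0 < P.du.tD - t := by linarith
  have : deriv P.du.Xl ξ * (P.du.tD - t) = P.du.Xl P.du.tD - P.du.Xl t := by rw [hslope]; field_simp
  nlinarith

/-- **`|α - π/2| ≤ s` on the stub set.** [folklore] -/
theorem stubU_abs_α_sub_le {t : ℝ} (he₀ : 0 < e₀) (hκ2 : 2 * P.κD * e₀ ≤ 1) (ht : t ∈ P.stubSetUp) : |P.Ru.α t - π / 2| ≤ P.sαU := by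
  have hv := (c.liteVminU2_spec P.μ_pos).1
  have hA0 : 0 ≤ P.AαU := P.AαU_nonneg he₀.le
  rcases eq_or_lt_of_le ht.1.2 with h | h
  · rw [h, show P.Ru.α P.du.tD = π / 2 from P.Ru.α_tD, sub_self, abs_zero]; exact P.sαU_nonneg he₀.le
  -- mean value theorem for `α` on `[t, t_D]`
  have hwin : ∀ s ∈ Icc t P.du.tD, P.du.H₁ s ∈ Ioo P.Ru.w₁ P.Ru.w₂ := fun s hs ↦ by
    have hs' : s ∈ P.stubSetUp := stubU_of_le ht hs.1 hs.2
    show P.du.H₁ s ∈ Ioo (P.du.hr0 - 2 * P.μ) (P.du.hr1 + P.μ)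
    rw [H₁_eq_Hh_of_le_up hs.2]; exact stubU_Hh_win hs'
  have hcont : ContinuousOn P.Ru.α (Icc t P.du.tD) := fun s hs ↦
    (P.Ru.contDiffAt_α (hwin s hs) (stubU_θ_mem_Ioo (stubU_of_le ht hs.1 hs.2))).continuousAt.continuousWithinAt
  have hdiff : ∀ s ∈ Ioo t P.du.tD, HasDerivAt P.Ru.α (deriv P.Ru.α s) s := fun s hs ↦
    (stubU_hasDerivAt_α (stubU_of_le ht hs.1.le hs.2.le) hs.2).differentiableAt.hasDerivAt
  obtain ⟨ξ, hξ, hslope⟩ := exists_hasDerivAt_eq_slope P.Ru.α (deriv P.Ru.α) h hcont hdiff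
  have hξs : ξ ∈ P.stubSetUp := stubU_of_le ht hξ.1.le hξ.2.le
  have hb := stubU_deriv_α_abs_le he₀ hκ2 hξs hξ.2
  have htime := stubU_tD_sub_le ht
  have hpos : 0 < P.du.tD - t := by linarith
  have heq : P.Ru.α t - π / 2 = -(deriv P.Ru.α ξ * (P.du.tD - t)) := by
    rw [hslope, show P.Ru.α P.du.tD = π / 2 from P.Ru.α_tD]; field_simp; ring
  rw [heq, abs_neg, abs_mul, abs_of_pos hpos, sαU]
  calc |deriv P.Ru.α ξ| * (P.du.tD - t) ≤ P.AαU * (P.κD / c.liteVminU2 P.μ_pos) :=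
        mul_le_mul hb htime hpos.le hA0
    _ = P.AαU * P.κD / c.liteVminU2 P.μ_pos := by ring

/-! ### The height decreases on the stub set -/

/-- **`ẏ < 0` below the tip on the stub set**, under the three smallness hypotheses. [cite: Kirby1989, Ch. I §4] -/
theorem stubU_deriv_y_neg (he₀ : 0 < e₀) (hκ2 : 2 * P.κD * e₀ ≤ 1) (hs1 : P.sαU ≤ 2⁻¹) (hs2 : 4 * c.cmax * P.sαU ≤ 1)
    (hs3 : 8 * c.qmaxc * P.MΘ * c.liteMHU * P.sαU < c.liteVminU2 P.μ_pos * e₀)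
    {t : ℝ} (ht : t ∈ P.stubSetUp) (ht' : t < P.du.tD) : deriv P.Ru.y t < 0 := by
  rw [(stubU_hasDerivAt_y ht ht').deriv]
  have hv := (c.liteVminU2_spec P.μ_pos).1
  have hr := stubU_r_mem he₀ ht
  have hR : 0 < P.Ru.r t := by linarith [hr.1, P.rDu_mem.1]
  have hX := stubU_vmin_le ht
  have hvd : P.du.vmin = c.liteVminU2 P.μ_pos := rfl
  rw [hvd] at hX
  have hr' : -(deriv P.du.Xl t) * e₀ < 0 := by nlinarith
  have hα := stubU_abs_α_sub_le he₀ hκ2 ht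
  have hcos : |cos (P.Ru.α t)| ≤ P.sαU := (abs_cos_le_abs_sub_pi_div_two _).trans hα
  have hsin : 7 / 8 ≤ sin (P.Ru.α t) := by
    have h := one_sub_sq_le_sin hα
    have : P.sαU ^ 2 ≤ 4⁻¹ := by have := P.sαU_nonneg he₀.le; nlinarith
    linarith
  have hq0 : 0 ≤ twistQ P.tw (P.Ru.r t) (P.Ru.θ t) := (twistQ_pos _ _ (stubU_θ_mem_Ioo ht)).le
  have hq := stubU_q_le he₀ hκ2 ht
  have hθ' := stubU_θ'_abs_le ht
  apply curveY_deriv_neg_of_nearVertical_abs hR hr' (by linarith) hq0 hcos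
  · -- `r |c| s ≤ 1/2`
    have hc := P.abs_tw_le
    have hr2 : P.Ru.r t ≤ 2 := by linarith [hr.2]
    have hs0 := P.sαU_nonneg he₀.le
    calc P.Ru.r t * |P.tw| * P.sαU ≤ 2 * c.cmax * P.sαU := by
          apply mul_le_mul_of_nonneg_right _ hs0
          exact mul_le_mul hr2 hc (abs_nonneg _) (by norm_num)
      _ ≤ 1 / 2 := by linarith
  · -- the mixing term against the radial decrease
    have hs0 := P.sαU_nonneg he₀.le
    have hr2 : P.Ru.r t ≤ 2 := by linarith [hr.2]
    have hlhs : P.Ru.r t * twistQ P.tw (P.Ru.r t) (P.Ru.θ t) * |deriv c.ΘB (1 - P.du.Hh t) * deriv P.du.Hh t| * P.sαU ≤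
        2 * c.qmaxc * (P.MΘ * c.liteMHU) * P.sαU := by
      apply mul_le_mul_of_nonneg_right _ hs0
      exact mul_le_mul (mul_le_mul hr2 hq hq0 (by norm_num)) hθ' (abs_nonneg _) (by have := c.qmaxc_pos; positivity)
    have hrhs : c.liteVminU2 P.μ_pos * e₀ * (7 / 8) / 2 ≤ -(-(deriv P.du.Xl t) * e₀) * sin (P.Ru.α t) / 2 := by
      simp only [neg_mul, neg_neg]
      have : c.liteVminU2 P.μ_pos * e₀ ≤ deriv P.du.Xl t * e₀ := mul_le_mul_of_nonneg_right hX he₀.le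
      have h78 : 0 ≤ sin (P.Ru.α t) - 7 / 8 := by linarith
      nlinarith [mul_nonneg (mul_nonneg (hv.le.trans hX) he₀.le) h78]
    nlinarith

/-- **The stub stays above the tip**: `y t > r_D` for stub parameters `t < t_D`. [cite: Kirby1989, Ch. I §4] -/
theorem rDu_lt_y_of_mem_stubSetUp (he₀ : 0 < e₀) (hκ2 : 2 * P.κD * e₀ ≤ 1) (hs1 : P.sαU ≤ 2⁻¹) (hs2 : 4 * c.cmax * P.sαU ≤ 1)
    (hs3 : 8 * c.qmaxc * P.MΘ * c.liteMHU * P.sαU < c.liteVminU2 P.μ_pos * e₀)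
    {t : ℝ} (ht : t ∈ P.stubSetUp) (ht' : t < P.du.tD) : P.rDu < P.Ru.y t := by
  have hwin : ∀ s ∈ Icc t P.du.tD, P.du.H₁ s ∈ Ioo P.Ru.w₁ P.Ru.w₂ := fun s hs ↦ by
    show P.du.H₁ s ∈ Ioo (P.du.hr0 - 2 * P.μ) (P.du.hr1 + P.μ)
    rw [H₁_eq_Hh_of_le_up hs.2]; exact stubU_Hh_win (stubU_of_le ht hs.1 hs.2)
  have hcont : ContinuousOn P.Ru.y (Icc t P.du.tD) := fun s hs ↦
    (P.Ru.contDiffAt_y (hwin s hs) (stubU_θ_mem_Ioo (stubU_of_le ht hs.1 hs.2))).continuousAt.continuousWithinAt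
  have hanti : StrictAntiOn P.Ru.y (Icc t P.du.tD) := by
    refine strictAntiOn_of_deriv_neg (convex_Icc _ _) hcont fun s hs ↦ ?_
    rw [interior_Icc] at hs
    exact stubU_deriv_y_neg he₀ hκ2 hs1 hs2 hs3 (stubU_of_le ht hs.1.le hs.2.le) hs.2
  have hy : P.Ru.y P.du.tD = P.rDu := by
    rw [P.Ru.y_tD]; rfl
  rw [← hy]
  exact hanti (left_mem_Icc.2 ht'.le) (right_mem_Icc.2 ht'.le) ht'

/-- The weak form, including the tip. [folklore] -/
theorem rDu_le_y_of_mem_stubSetUp (he₀ : 0 < e₀) (hκ2 : 2 * P.κD * e₀ ≤ 1) (hs1 : P.sαU ≤ 2⁻¹) (hs2 : 4 * c.cmax * P.sαU ≤ 1)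
    (hs3 : 8 * c.qmaxc * P.MΘ * c.liteMHU * P.sαU < c.liteVminU2 P.μ_pos * e₀)
    {t : ℝ} (ht : t ∈ P.stubSetUp) : P.rDu ≤ P.Ru.y t := by
  rcases eq_or_lt_of_le ht.1.2 with h | h
  · rw [h, P.Ru.y_tD]; exact le_of_eq rfl
  · exact (rDu_lt_y_of_mem_stubSetUp he₀ hκ2 hs1 hs2 hs3 ht h).le

end SlideChoice

end BandCore

end Literature.Topology.FourManifolds
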